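import Summits.RiemannHypothesis.RiemannHypothesis.Theorems.TiltedLandingLaw421Seam08

/-! # TiltedLandingLaw421 — descent seam, part 09
Token-identical port of the descent framework of `Cruxes/TiltedLandingLaw421/Lines/law421birthS.lean`
(seam canon ce03e18b) into flat Theorems modules, so that crux line files can import it instead of inlining it.
No new mathematics; no `sorry`; no route (Theses) imports — the tree statement is mirrored as `RhW07.Seam.Law421Statement`. -/

open Complex Metric Set
open scoped ComplexConjugate
namespace RhIdea6.G20.W07C12.Frac
open Set Complex
open RhIdea6.G17.W07C7 RhIdea6.G17.W07C7.Rev6 RhIdea6.G18.W07C8.Law421BirthS RhIdea6.G19.W07C11.Seam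

/-- `vNonneg_LQ` — seam of the TiltedLandingLaw421 descent framework, part 09 (token-identical port of `Cruxes/TiltedLandingLaw421/Lines/law421birthS.lean`; no new mathematics). -/
theorem vNonneg_LQ (St : StatePred) : VNonnegSig VLQ St := by
  intro η f x₀ s hmax R Hs B hE j u _
  obtain ⟨-, -, -, hs, -⟩ := hE
  simp only [VLQ]
  have h1 : 0 ≤ 4 * |u.im| / s := div_nonneg (by positivity) hs.le
  have h2 : 0 ≤ (|u.im| / s) ^ 2 := sq_nonneg _
  linarith

/-- `initV_lin` — seam of the TiltedLandingLaw421 descent framework, part 09 (token-identical port of `Cruxes/TiltedLandingLaw421/Lines/law421birthS.lean`; no new mathematics). -/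
theorem initV_lin {μ cE c : ℝ} (hμ : 0 < μ)
    (hbud : ∀ s hmax : ℝ, 0 < s → 2 * s ≤ hmax → hmax / (μ * s) + cE ≤ 4 * hmax / s + c)
    {St : StatePred} (hI : Init0Sig St) : InitVSig c (PLin cE) (VLin μ) St := by
  intro η f x₀ s hmax R Hs B hE
  have hE' := hE
  obtain ⟨-, -, -, hs, hsh, -⟩ := hE'
  obtain ⟨u, hSt, hu⟩ := hI η f x₀ s hmax R Hs B hE
  refine ⟨u, hSt, ?_⟩
  have hμs : 0 < μ * s := mul_pos hμ hs
  have h1 : |u.im| / (μ * s) ≤ hmax / (μ * s) := div_le_div_of_nonneg_right hu hμs.le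
  have h2 := hbud s hmax hs hsh
  simp only [VLin, PLin]
  linarith

/-- `initV_lin_quarter` — seam of the TiltedLandingLaw421 descent framework, part 09 (token-identical port of `Cruxes/TiltedLandingLaw421/Lines/law421birthS.lean`; no new mathematics). -/
theorem initV_lin_quarter {μ cE c : ℝ} (hμ : 1 / 4 ≤ μ) (hcE : cE ≤ c) {St : StatePred} (hI : Init0Sig St) :
    InitVSig c (PLin cE) (VLin μ) St :=
  initV_lin (by linarith) (fun _ _ hs hsh => budget_of_quarter_le' hμ hcE hs hsh) hI

/-- `initV_LQ` — seam of the TiltedLandingLaw421 descent framework, part 09 (token-identical port of `Cruxes/TiltedLandingLaw421/Lines/law421birthS.lean`; no new mathematics). -/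
theorem initV_LQ {cB c : ℝ} (hcc : cB ≤ c) {St : StatePred} (hI : Init0Sig St)
    (hZ : ∀ (η : ℝ) (f : ℂ → ℂ) (x₀ s hmax R Hs : ℝ) (B : ℕ) (u : ℂ), St η f x₀ s hmax R Hs B 0 u → f u = 0) :
    InitVSig c (PB cB) VLQ St := by
  intro η f x₀ s hmax R Hs B hE
  have hE' := hE
  obtain ⟨-, -, -, hs, hsh, -, -, hHs, hstrip, -⟩ := hE'
  obtain ⟨u, hSt, hu⟩ := hI η f x₀ s hmax R Hs B hE
  refine ⟨u, hSt, ?_⟩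
  have hfu : f u = 0 := hZ η f x₀ s hmax R Hs B u hSt
  have huH : |u.im| ≤ Hs := hstrip u hfu
  have h1 : 4 * |u.im| / s ≤ 4 * hmax / s := div_le_div_of_nonneg_right (by linarith) hs.le
  have h0 : 0 ≤ |u.im| / s := div_nonneg (abs_nonneg _) hs.le
  have hle : |u.im| / s ≤ Hs / s := div_le_div_of_nonneg_right huH hs.le
  have h2 : (|u.im| / s) ^ 2 ≤ (Hs / s) ^ 2 := sq_le_sq' (by linarith) hle
  simp only [VLQ, PB]
  linarith

/-- `stCol_level0_zero` — seam of the TiltedLandingLaw421 descent framework, part 09 (token-identical port of `Cruxes/TiltedLandingLaw421/Lines/law421birthS.lean`; no new mathematics). -/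
theorem stCol_level0_zero (η : ℝ) (f : ℂ → ℂ) (x₀ s hmax R Hs : ℝ) (B : ℕ) (u : ℂ)
    (h : StCol η f x₀ s hmax R Hs B 0 u) : f u = 0 := by
  have h2 := h.2.1
  rwa [iteratedDeriv_zero] at h2

/-- `initV_LQ_stCol` — seam of the TiltedLandingLaw421 descent framework, part 09 (token-identical port of `Cruxes/TiltedLandingLaw421/Lines/law421birthS.lean`; no new mathematics). -/
theorem initV_LQ_stCol {cB c : ℝ} (hcc : cB ≤ c) : InitVSig c (PB cB) VLQ StCol :=
  initV_LQ hcc init0Sig_stCol stCol_level0_zero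

/-- `fracCensus_lin_of_liftV'` — seam of the TiltedLandingLaw421 descent framework, part 09 (token-identical port of `Cruxes/TiltedLandingLaw421/Lines/law421birthS.lean`; no new mathematics). -/
theorem fracCensus_lin_of_liftV' {μ cE : ℝ} (hμ : 0 < μ) {St Ready Frozen : StatePred}
    (hS : SurplusLiftSigV' μ cE St Ready Frozen) (hF : FrozenStepSig μ St Ready Frozen) :
    FracCensusSig (PLin cE) (VLin μ) St Ready := by
  intro η f x₀ s hmax R Hs B hE
  have hE' := hE
  obtain ⟨-, -, -, hs, -⟩ := hE'
  have hμs : 0 < μ * s := mul_pos hμ hs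
  obtain ⟨E, lam, hlam0, hsum, hoff, hon⟩ := hS η f x₀ s hmax R Hs B hE
  have hw0 : ∀ j, 0 ≤ lam j / (μ * s) := fun j => div_nonneg (hlam0 j) hμs.le

  have hch0 : ∀ j : ℕ, 0 ≤ (if j ∈ E then 1 + lam j / (μ * s) else 0 : ℝ) := by
    intro j
    by_cases hj : j ∈ E
    · rw [if_pos hj]
      linarith [hw0 j]
    · simp only [if_neg hj, le_refl]
  have hchP : ∀ N : ℕ, ∑ j ∈ Finset.range N, (if j ∈ E then 1 + lam j / (μ * s) else 0 : ℝ) ≤ PLin cE s hmax Hs B := by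
    intro N
    have h1 : ∑ j ∈ Finset.range N, (if j ∈ E then 1 + lam j / (μ * s) else 0 : ℝ) =
        ∑ j ∈ (Finset.range N).filter (fun j => j ∈ E), (1 + lam j / (μ * s)) := by
      rw [Finset.sum_filter]
    have h2 : ∑ j ∈ (Finset.range N).filter (fun j => j ∈ E), (1 + lam j / (μ * s)) ≤ ∑ j ∈ E, (1 + lam j / (μ * s)) := by
      apply Finset.sum_le_sum_of_subset_of_nonneg
      · intro j hj
        exact (Finset.mem_filter.mp hj).2
      · intro j _ _
        linarith [hw0 j]
    have h3 : ∑ j ∈ E, (1 + lam j / (μ * s)) = (E.card : ℝ) + (∑ e ∈ E, lam e) / (μ * s) := by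
      rw [Finset.sum_add_distrib, Finset.sum_const, nsmul_eq_mul, mul_one, Finset.sum_div]
    simp only [PLin]
    linarith
  have hstep : ∀ (j : ℕ) (u : ℂ), St η f x₀ s hmax R Hs B j u → ¬ Ready η f x₀ s hmax R Hs B j u →
      ∃ u' : ℂ, St η f x₀ s hmax R Hs B (j + 1) u' ∧
        VLin μ η f x₀ s hmax R Hs B (j + 1) u' + 1 ≤ VLin μ η f x₀ s hmax R Hs B j u + (if j ∈ E then 1 + lam j / (μ * s) else 0 : ℝ) := by
    intro j u hSt hR
    by_cases hjE : j ∈ E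
    · obtain ⟨u', hSt', hle⟩ := hon j u hjE hSt hR
      refine ⟨u', hSt', ?_⟩
      have hh : |u'.im| / (μ * s) ≤ |u.im| / (μ * s) + lam j / (μ * s) := by
        rw [← add_div]
        exact div_le_div_of_nonneg_right hle hμs.le
      rw [if_pos hjE]
      simp only [VLin]
      linarith
    · rcases hoff j u hjE hSt with hRj | hFz
      · exact absurd hRj hR
      obtain ⟨u', hSt', hdrop⟩ := hF η f x₀ s hmax R Hs B hE j u hSt hFz hR
      refine ⟨u', hSt', ?_⟩
      have hh : |u'.im| / (μ * s) + 1 ≤ |u.im| / (μ * s) := by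
        rw [← sub_nonneg]
        have : |u.im| / (μ * s) - (|u'.im| / (μ * s) + 1) = (|u.im| - |u'.im| - μ * s) / (μ * s) := by
          field_simp
          ring
        rw [this]
        exact div_nonneg (by linarith) hμs.le
      rw [if_neg hjE]
      simp only [VLin]
      linarith
  exact ⟨fun j => if j ∈ E then 1 + lam j / (μ * s) else 0, hch0, hchP, hstep⟩

/-- `descentSigC_of_fracLin` — seam of the TiltedLandingLaw421 descent framework, part 09 (token-identical port of `Cruxes/TiltedLandingLaw421/Lines/law421birthS.lean`; no new mathematics). -/
theorem descentSigC_of_fracLin {μ cE c : ℝ} (hμ : 1 / 4 ≤ μ) (hcE : cE ≤ c) (hc : 0 ≤ c) {St Ready : StatePred}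
    (hI : Init0Sig St) (hC : FracCensusSig (PLin cE) (VLin μ) St Ready) (hL : LandLeSig St Ready) : DescentSigC c :=
  descentSigC_of_fracCensus c hc (PLin cE) (VLin μ) St Ready (vNonneg_lin (by linarith) St) (initV_lin_quarter hμ hcE hI) hC hL

/-- `descentSigS'_of_fracLin` — seam of the TiltedLandingLaw421 descent framework, part 09 (token-identical port of `Cruxes/TiltedLandingLaw421/Lines/law421birthS.lean`; no new mathematics). -/
theorem descentSigS'_of_fracLin {μ : ℝ} (hμ : 1 / 4 ≤ μ) {St Ready : StatePred}
    (hI : Init0Sig St) (hC : FracCensusSig (PLin 1) (VLin μ) St Ready) (hL : LandLeSig St Ready) : DescentSigS' :=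
  descentSigS'_of_descentSigC (descentSigC_of_fracLin hμ le_rfl zero_le_one hI hC hL)

/-- `descentSigS_of_fracLin` — seam of the TiltedLandingLaw421 descent framework, part 09 (token-identical port of `Cruxes/TiltedLandingLaw421/Lines/law421birthS.lean`; no new mathematics). -/
theorem descentSigS_of_fracLin {μ : ℝ} (hμ : 1 / 4 ≤ μ) {St Ready : StatePred}
    (hI : Init0Sig St) (hC : FracCensusSig (PLin 0) (VLin μ) St Ready) (hL : LandLeSig St Ready) : DescentSigS :=
  descentSigS_of_descentSigC (descentSigC_of_fracLin hμ le_rfl le_rfl hI hC hL)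

/-- `descentSigC_of_fracLQ` — seam of the TiltedLandingLaw421 descent framework, part 09 (token-identical port of `Cruxes/TiltedLandingLaw421/Lines/law421birthS.lean`; no new mathematics). -/
theorem descentSigC_of_fracLQ {c : ℝ} (hc : 0 ≤ c) {Ready : StatePred}
    (hC : FracCensusSig (PB c) VLQ StCol Ready) (hL : LandLeSig StCol Ready) : DescentSigC c :=
  descentSigC_of_fracCensus c hc (PB c) VLQ StCol Ready (vNonneg_LQ StCol) (initV_LQ_stCol le_rfl) hC hL

/-- `descentSigS'_of_fracLQ` — seam of the TiltedLandingLaw421 descent framework, part 09 (token-identical port of `Cruxes/TiltedLandingLaw421/Lines/law421birthS.lean`; no new mathematics). -/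
theorem descentSigS'_of_fracLQ {Ready : StatePred} (hC : FracCensusSig (PB 1) VLQ StCol Ready) (hL : LandLeSig StCol Ready) :
    DescentSigS' :=
  descentSigS'_of_descentSigC (descentSigC_of_fracLQ zero_le_one hC hL)

/-- `descentSigS_of_fracLQ` — seam of the TiltedLandingLaw421 descent framework, part 09 (token-identical port of `Cruxes/TiltedLandingLaw421/Lines/law421birthS.lean`; no new mathematics). -/
theorem descentSigS_of_fracLQ {Ready : StatePred} (hC : FracCensusSig (PB 0) VLQ StCol Ready) (hL : LandLeSig StCol Ready) :
    DescentSigS :=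
  descentSigS_of_descentSigC (descentSigC_of_fracLQ le_rfl hC hL)

/-- `FracLin` — seam of the TiltedLandingLaw421 descent framework, part 09 (token-identical port of `Cruxes/TiltedLandingLaw421/Lines/law421birthS.lean`; no new mathematics). -/
def FracLin : Prop := FracCensusSig (PLin 1) (VLin (1 / 4)) StCol (CumReady WindowReady)

/-- `FracLQ` — seam of the TiltedLandingLaw421 descent framework, part 09 (token-identical port of `Cruxes/TiltedLandingLaw421/Lines/law421birthS.lean`; no new mathematics). -/
def FracLQ : Prop := FracCensusSig (PB 1) VLQ StCol (CumReady WindowReady)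

/-- `FracLin0` — seam of the TiltedLandingLaw421 descent framework, part 09 (token-identical port of `Cruxes/TiltedLandingLaw421/Lines/law421birthS.lean`; no new mathematics). -/
def FracLin0 : Prop := FracCensusSig (PLin 0) (VLin (1 / 4)) StCol (CumReady WindowReady)

/-- `FracLQ0` — seam of the TiltedLandingLaw421 descent framework, part 09 (token-identical port of `Cruxes/TiltedLandingLaw421/Lines/law421birthS.lean`; no new mathematics). -/
def FracLQ0 : Prop := FracCensusSig (PB 0) VLQ StCol (CumReady WindowReady)

/-- `descentSigS'_of_fracLinSlot` — seam of the TiltedLandingLaw421 descent framework, part 09 (token-identical port of `Cruxes/TiltedLandingLaw421/Lines/law421birthS.lean`; no new mathematics). -/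
theorem descentSigS'_of_fracLinSlot (h : FracLin) : DescentSigS' :=
  descentSigS'_of_fracLin le_rfl init0Sig_stCol h (landLeSig_cumReady StCol)

/-- `descentSigS'_of_fracLQSlot` — seam of the TiltedLandingLaw421 descent framework, part 09 (token-identical port of `Cruxes/TiltedLandingLaw421/Lines/law421birthS.lean`; no new mathematics). -/
theorem descentSigS'_of_fracLQSlot (h : FracLQ) : DescentSigS' :=
  descentSigS'_of_fracLQ h (landLeSig_cumReady StCol)

/-- `descentSigS_of_fracLin0Slot` — seam of the TiltedLandingLaw421 descent framework, part 09 (token-identical port of `Cruxes/TiltedLandingLaw421/Lines/law421birthS.lean`; no new mathematics). -/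
theorem descentSigS_of_fracLin0Slot (h : FracLin0) : DescentSigS :=
  descentSigS_of_fracLin le_rfl init0Sig_stCol h (landLeSig_cumReady StCol)

/-- `descentSigS_of_fracLQ0Slot` — seam of the TiltedLandingLaw421 descent framework, part 09 (token-identical port of `Cruxes/TiltedLandingLaw421/Lines/law421birthS.lean`; no new mathematics). -/
theorem descentSigS_of_fracLQ0Slot (h : FracLQ0) : DescentSigS :=
  descentSigS_of_fracLQ h (landLeSig_cumReady StCol)

/-- `fracLin_of_liftSV1` — seam of the TiltedLandingLaw421 descent framework, part 09 (token-identical port of `Cruxes/TiltedLandingLaw421/Lines/law421birthS.lean`; no new mathematics). -/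
theorem fracLin_of_liftSV1 (h : SurplusLiftSigV' (1 / 4) 1 StCol WindowReady (SuccS (1 / 4))) : FracLin :=
  fracCensus_cumReady_of (fracCensus_lin_of_liftV' (by norm_num) h (frozenStepSig_succS (1 / 4) WindowReady))

/-- `fracCensusLin_of_liftSV1` — seam of the TiltedLandingLaw421 descent framework, part 09 (token-identical port of `Cruxes/TiltedLandingLaw421/Lines/law421birthS.lean`; no new mathematics). -/
theorem fracCensusLin_of_liftSV1 (h : SurplusLiftSigV' (1 / 4) 1 StCol WindowReady (SuccS (1 / 4))) :
    FracCensusSig (PLin 1) (VLin (1 / 4)) StCol WindowReady :=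
  fracCensus_lin_of_liftV' (by norm_num) h (frozenStepSig_succS (1 / 4) WindowReady)

/-- `law421T_of_fracLin` — seam of the TiltedLandingLaw421 descent framework, part 09 (token-identical port of `Cruxes/TiltedLandingLaw421/Lines/law421birthS.lean`; no new mathematics). -/
private theorem law421T_of_fracLin (h : FracLin) (hHer : AnalyticHereditySig) :
    RhW07.Seam.Law421Statement :=
  law421T_ofS' (descentSigS'_of_fracLinSlot h) hHer

/-- `law421T_of_fracLQ` — seam of the TiltedLandingLaw421 descent framework, part 09 (token-identical port of `Cruxes/TiltedLandingLaw421/Lines/law421birthS.lean`; no new mathematics). -/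
private theorem law421T_of_fracLQ (h : FracLQ) (hHer : AnalyticHereditySig) :
    RhW07.Seam.Law421Statement :=
  law421T_ofS' (descentSigS'_of_fracLQSlot h) hHer

/-- `law421T_of_fracLin0` — seam of the TiltedLandingLaw421 descent framework, part 09 (token-identical port of `Cruxes/TiltedLandingLaw421/Lines/law421birthS.lean`; no new mathematics). -/
private theorem law421T_of_fracLin0 (h : FracLin0) (hHer : AnalyticHereditySig) :
    RhW07.Seam.Law421Statement :=
  law421T_ofS' (descentSigS'_of_descentSigS (descentSigS_of_fracLin0Slot h)) hHer

/-- `law421T_of_fracLQ0` — seam of the TiltedLandingLaw421 descent framework, part 09 (token-identical port of `Cruxes/TiltedLandingLaw421/Lines/law421birthS.lean`; no new mathematics). -/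
private theorem law421T_of_fracLQ0 (h : FracLQ0) (hHer : AnalyticHereditySig) :
    RhW07.Seam.Law421Statement :=
  law421T_ofS' (descentSigS'_of_descentSigS (descentSigS_of_fracLQ0Slot h)) hHer

end RhIdea6.G20.W07C12.Frac
namespace RhIdea6.G20.W07C12.StColP
open Set Complex
open RhIdea6.G17.W07C7 RhIdea6.G17.W07C7.Rev6 RhIdea6.G18.W07C8.Law421BirthS RhIdea6.G19.W07C11.Seam RhIdea6.G20.W07C12.Frac
/-- `StCol'` — seam of the TiltedLandingLaw421 descent framework, part 09 (token-identical port of `Cruxes/TiltedLandingLaw421/Lines/law421birthS.lean`; no new mathematics). -/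
def StCol' : StatePred := fun _η f x₀ s _hmax R Hs _B j u =>
  iteratedDeriv j f ≠ 0 ∧ iteratedDeriv j f u = 0 ∧ 0 < u.im ∧ |u.re - x₀| ≤ R / 2 + (j : ℝ) * (s / 4) ∧ u.im ≤ Hs

/-- `SuccS'` — seam of the TiltedLandingLaw421 descent framework, part 09 (token-identical port of `Cruxes/TiltedLandingLaw421/Lines/law421birthS.lean`; no new mathematics). -/
def SuccS' (μ : ℝ) : StatePred := fun η f x₀ s hmax R Hs B j u =>
  ∃ u' : ℂ, StCol' η f x₀ s hmax R Hs B (j + 1) u' ∧ |u'.im| + μ * s ≤ |u.im|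

/-- `frozenStepSig_succS'` — seam of the TiltedLandingLaw421 descent framework, part 09 (token-identical port of `Cruxes/TiltedLandingLaw421/Lines/law421birthS.lean`; no new mathematics). -/
theorem frozenStepSig_succS' (μ : ℝ) (Ready : StatePred) : FrozenStepSig μ StCol' Ready (SuccS' μ) :=
  fun _ _ _ _ _ _ _ _ _ _ _ _ hF _ => hF

/-- `stColP_of_stCol` — seam of the TiltedLandingLaw421 descent framework, part 09 (token-identical port of `Cruxes/TiltedLandingLaw421/Lines/law421birthS.lean`; no new mathematics). -/
theorem stColP_of_stCol {η : ℝ} {f : ℂ → ℂ} {x₀ s hmax R Hs : ℝ} {B j : ℕ} {u : ℂ}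
    (hstripj : ∀ w : ℂ, iteratedDeriv j f w = 0 → |w.im| ≤ Hs) (h : StCol η f x₀ s hmax R Hs B j u) :
    StCol' η f x₀ s hmax R Hs B j u :=
  ⟨h.1, h.2.1, h.2.2.1, h.2.2.2.1, le_trans (le_abs_self _) (hstripj u h.2.1)⟩

/-- `stCol_of_stColP` — seam of the TiltedLandingLaw421 descent framework, part 09 (token-identical port of `Cruxes/TiltedLandingLaw421/Lines/law421birthS.lean`; no new mathematics). -/
theorem stCol_of_stColP {η : ℝ} {f : ℂ → ℂ} {x₀ s hmax R Hs : ℝ} {B j : ℕ} {u : ℂ}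
    (h : StCol' η f x₀ s hmax R Hs B j u) (hu : u.im ≤ hmax) : StCol η f x₀ s hmax R Hs B j u :=
  ⟨h.1, h.2.1, h.2.2.1, h.2.2.2.1, hu⟩

/-- `init0Sig_stCol'` — seam of the TiltedLandingLaw421 descent framework, part 09 (token-identical port of `Cruxes/TiltedLandingLaw421/Lines/law421birthS.lean`; no new mathematics). -/
theorem init0Sig_stCol' : Init0Sig StCol' := by
  intro η f x₀ s hmax R Hs B hE
  obtain ⟨hdiff, hreal, -, hs, hsh, -, h3R, hHs, hstrip, -, ⟨w₀, hw0, hwim, hwre, hwh⟩, -⟩ := hE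
  have hf : iteratedDeriv 0 f ≠ 0 := by
    intro hf0
    rw [iteratedDeriv_zero] at hf0
    have h := hstrip ((Hs + 1 : ℝ) * I) (by rw [hf0]; rfl)
    have him : (((Hs + 1 : ℝ) : ℂ) * I).im = Hs + 1 := by simp
    rw [him, abs_of_nonneg (by linarith)] at h
    linarith
  have hR : |x₀ - x₀| ≤ R / 2 + ((0 : ℕ) : ℝ) * (s / 4) := by
    rw [sub_self, abs_zero]; push_cast; nlinarith
  have hwabs : |w₀.im| ≤ hmax := hwh
  have hwHs : |w₀.im| ≤ Hs := hstrip w₀ hw0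
  rcases lt_or_gt_of_ne hwim with hneg | hpos
  · refine ⟨conj w₀, ⟨hf, ?_, ?_, ?_, ?_⟩, ?_⟩
    · rw [iteratedDeriv_zero, Literature.Analysis.Complex.apply_conj_eq_conj hdiff hreal, hw0, map_zero]
    · rw [Complex.conj_im]; linarith
    · rw [Complex.conj_re, hwre]; exact hR
    · rw [Complex.conj_im]; rw [abs_of_neg hneg] at hwHs; exact hwHs
    · rw [Complex.conj_im, abs_neg]; exact hwh
  · refine ⟨w₀, ⟨hf, ?_, hpos, ?_, ?_⟩, hwh⟩
    · rw [iteratedDeriv_zero]; exact hw0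
    · rw [hwre]; exact hR
    · exact le_trans (le_abs_self _) hwHs

/-- `landSig_stCol'` — seam of the TiltedLandingLaw421 descent framework, part 09 (token-identical port of `Cruxes/TiltedLandingLaw421/Lines/law421birthS.lean`; no new mathematics). -/
theorem landSig_stCol' : LandSig StCol' WindowReady :=
  landSig_windowReady StCol' (fun _ _ _ _ _ _ _ _ _ _ h => h.1)

/-- `landLeSig_stCol'` — seam of the TiltedLandingLaw421 descent framework, part 09 (token-identical port of `Cruxes/TiltedLandingLaw421/Lines/law421birthS.lean`; no new mathematics). -/
theorem landLeSig_stCol' : LandLeSig StCol' (CumReady WindowReady) :=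
  landLeSig_cumReady StCol'

/-- `stColP_level0_zero` — seam of the TiltedLandingLaw421 descent framework, part 09 (token-identical port of `Cruxes/TiltedLandingLaw421/Lines/law421birthS.lean`; no new mathematics). -/
theorem stColP_level0_zero (η : ℝ) (f : ℂ → ℂ) (x₀ s hmax R Hs : ℝ) (B : ℕ) (u : ℂ)
    (h : StCol' η f x₀ s hmax R Hs B 0 u) : f u = 0 := by
  have h2 := h.2.1
  rwa [iteratedDeriv_zero] at h2

/-- `descentSigS'_of_piecesSV1P` — seam of the TiltedLandingLaw421 descent framework, part 09 (token-identical port of `Cruxes/TiltedLandingLaw421/Lines/law421birthS.lean`; no new mathematics). -/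
theorem descentSigS'_of_piecesSV1P (h : SurplusLiftSigV' (1 / 4) 1 StCol' WindowReady (SuccS' (1 / 4))) : DescentSigS' :=
  descentSigS'_of_liftV'_pieces (1 / 4) le_rfl StCol' WindowReady (SuccS' (1 / 4)) init0Sig_stCol' h
    (frozenStepSig_succS' (1 / 4) WindowReady) landSig_stCol'

/-- `descentSigS'_of_piecesV'P` — seam of the TiltedLandingLaw421 descent framework, part 09 (token-identical port of `Cruxes/TiltedLandingLaw421/Lines/law421birthS.lean`; no new mathematics). -/
theorem descentSigS'_of_piecesV'P {μ : ℝ} (hμ : 1 / 4 ≤ μ) (h : SurplusLiftSigV' μ 1 StCol' WindowReady (SuccS' μ)) : DescentSigS' :=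
  descentSigS'_of_liftV'_pieces μ hμ StCol' WindowReady (SuccS' μ) init0Sig_stCol' h (frozenStepSig_succS' μ WindowReady) landSig_stCol'

/-- `law421T_of_piecesSV1P` — seam of the TiltedLandingLaw421 descent framework, part 09 (token-identical port of `Cruxes/TiltedLandingLaw421/Lines/law421birthS.lean`; no new mathematics). -/
private theorem law421T_of_piecesSV1P (h : SurplusLiftSigV' (1 / 4) 1 StCol' WindowReady (SuccS' (1 / 4))) (hHer : AnalyticHereditySig) :
    RhW07.Seam.Law421Statement :=
  law421T_ofS' (descentSigS'_of_piecesSV1P h) hHer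

/-- `descent_core_stop` — seam of the TiltedLandingLaw421 descent framework, part 09 (token-identical port of `Cruxes/TiltedLandingLaw421/Lines/law421birthS.lean`; no new mathematics). -/
theorem descent_core_stop {St : ℕ → ℂ → Prop} {Stop : ℕ → Prop} {Φ : ℕ → ℂ → ℝ} {A : ℝ}
    (hS : ∀ (j : ℕ) (u : ℂ), St j u → (∀ j' : ℕ, j' ≤ j → ¬ Stop j') →
      ∃ u' : ℂ, St (j + 1) u' ∧ 0 ≤ Φ (j + 1) u' ∧ Φ (j + 1) u' + 1 ≤ Φ j u)
    {u₀ : ℂ} (h0 : St 0 u₀) (hΦ0 : Φ 0 u₀ ≤ A) (hA : 0 ≤ A) :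
    ∃ j : ℕ, (j : ℝ) ≤ A ∧ Stop j := by
  obtain ⟨j, u, hj, -, j', hj', hStop⟩ :=
    descent_core (St := St) (Ready := fun j _ => ∃ j' : ℕ, j' ≤ j ∧ Stop j') (Φ := Φ)
      (fun j u hSt hR => hS j u hSt (fun j' hj' hSj' => hR ⟨j', hj', hSj'⟩)) h0 hΦ0 hA
  have hjj : (j' : ℝ) ≤ j := by exact_mod_cast hj'
  exact ⟨j', by linarith, hStop⟩

/-- `surplusLiftSigV'_mono_ready` — seam of the TiltedLandingLaw421 descent framework, part 09 (token-identical port of `Cruxes/TiltedLandingLaw421/Lines/law421birthS.lean`; no new mathematics). -/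
theorem surplusLiftSigV'_mono_ready {μ cE : ℝ} {St Ready Ready' Frozen : StatePred}
    (hR : ∀ η f x₀ s hmax R Hs B j u, Ready η f x₀ s hmax R Hs B j u → Ready' η f x₀ s hmax R Hs B j u)
    (h : SurplusLiftSigV' μ cE St Ready Frozen) : SurplusLiftSigV' μ cE St Ready' Frozen := by
  intro η f x₀ s hmax R Hs B hE
  obtain ⟨E, lam, hlam0, hsum, hoff, hon⟩ := h η f x₀ s hmax R Hs B hE
  refine ⟨E, lam, hlam0, hsum, ?_, ?_⟩
  · intro j u hj hSt
    rcases hoff j u hj hSt with hRj | hFz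
    · exact Or.inl (hR _ _ _ _ _ _ _ _ _ _ hRj)
    · exact Or.inr hFz
  · intro j u hj hSt hR'
    exact hon j u hj hSt (fun hRj => hR' (hR _ _ _ _ _ _ _ _ _ _ hRj))

/-- `SurplusLiftSigStop` — seam of the TiltedLandingLaw421 descent framework, part 09 (token-identical port of `Cruxes/TiltedLandingLaw421/Lines/law421birthS.lean`; no new mathematics). -/
def SurplusLiftSigStop (μ cE : ℝ) : Prop := SurplusLiftSigV' μ cE StCol' (CumReady WindowReady) (SuccS' μ)

/-- `surplusLiftSigStop_of_plain` — seam of the TiltedLandingLaw421 descent framework, part 09 (token-identical port of `Cruxes/TiltedLandingLaw421/Lines/law421birthS.lean`; no new mathematics). -/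
theorem surplusLiftSigStop_of_plain {μ cE : ℝ} (h : SurplusLiftSigV' μ cE StCol' WindowReady (SuccS' μ)) : SurplusLiftSigStop μ cE :=
  surplusLiftSigV'_mono_ready (fun _ _ _ _ _ _ _ _ _ _ hRj => cumReady_of_ready hRj) h

/-- `fracCensusLinP_of_stop` — seam of the TiltedLandingLaw421 descent framework, part 09 (token-identical port of `Cruxes/TiltedLandingLaw421/Lines/law421birthS.lean`; no new mathematics). -/
theorem fracCensusLinP_of_stop {μ cE : ℝ} (hμ : 0 < μ) (h : SurplusLiftSigStop μ cE) :
    FracCensusSig (PLin cE) (VLin μ) StCol' (CumReady WindowReady) :=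
  fracCensus_lin_of_liftV' hμ h (frozenStepSig_succS' μ (CumReady WindowReady))

/-- `descentSigS'_of_stop` — seam of the TiltedLandingLaw421 descent framework, part 09 (token-identical port of `Cruxes/TiltedLandingLaw421/Lines/law421birthS.lean`; no new mathematics). -/
theorem descentSigS'_of_stop {μ : ℝ} (hμ : 1 / 4 ≤ μ) (h : SurplusLiftSigStop μ 1) : DescentSigS' :=
  descentSigS'_of_fracLin hμ init0Sig_stCol' (fracCensusLinP_of_stop (by linarith) h) (landLeSig_cumReady StCol')

/-- `descentSigS_of_stop0` — seam of the TiltedLandingLaw421 descent framework, part 09 (token-identical port of `Cruxes/TiltedLandingLaw421/Lines/law421birthS.lean`; no new mathematics). -/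
theorem descentSigS_of_stop0 {μ : ℝ} (hμ : 1 / 4 ≤ μ) (h : SurplusLiftSigStop μ 0) : DescentSigS :=
  descentSigS_of_fracLin hμ init0Sig_stCol' (fracCensusLinP_of_stop (by linarith) h) (landLeSig_cumReady StCol')

/-- `law421T_of_stop` — seam of the TiltedLandingLaw421 descent framework, part 09 (token-identical port of `Cruxes/TiltedLandingLaw421/Lines/law421birthS.lean`; no new mathematics). -/
private theorem law421T_of_stop (h : SurplusLiftSigStop (1 / 4) 1) (hHer : AnalyticHereditySig) :
    RhW07.Seam.Law421Statement :=
  law421T_ofS' (descentSigS'_of_stop le_rfl h) hHer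

/-- `FracLinP` — seam of the TiltedLandingLaw421 descent framework, part 09 (token-identical port of `Cruxes/TiltedLandingLaw421/Lines/law421birthS.lean`; no new mathematics). -/
def FracLinP : Prop := FracCensusSig (PLin 1) (VLin (1 / 4)) StCol' (CumReady WindowReady)

/-- `FracLQP` — seam of the TiltedLandingLaw421 descent framework, part 09 (token-identical port of `Cruxes/TiltedLandingLaw421/Lines/law421birthS.lean`; no new mathematics). -/
def FracLQP : Prop := FracCensusSig (PB 1) VLQ StCol' (CumReady WindowReady)

/-- `descentSigS'_of_fracLinP` — seam of the TiltedLandingLaw421 descent framework, part 09 (token-identical port of `Cruxes/TiltedLandingLaw421/Lines/law421birthS.lean`; no new mathematics). -/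
theorem descentSigS'_of_fracLinP (h : FracLinP) : DescentSigS' :=
  descentSigS'_of_fracLin le_rfl init0Sig_stCol' h (landLeSig_cumReady StCol')

/-- `initV_LQ_stColP` — seam of the TiltedLandingLaw421 descent framework, part 09 (token-identical port of `Cruxes/TiltedLandingLaw421/Lines/law421birthS.lean`; no new mathematics). -/
theorem initV_LQ_stColP {cB c : ℝ} (hcc : cB ≤ c) : InitVSig c (PB cB) VLQ StCol' :=
  initV_LQ hcc init0Sig_stCol' stColP_level0_zero

/-- `descentSigS'_of_fracLQP` — seam of the TiltedLandingLaw421 descent framework, part 09 (token-identical port of `Cruxes/TiltedLandingLaw421/Lines/law421birthS.lean`; no new mathematics). -/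
theorem descentSigS'_of_fracLQP (h : FracLQP) : DescentSigS' :=
  descentSigS'_of_descentSigC
    (descentSigC_of_fracCensus 1 zero_le_one (PB 1) VLQ StCol' (CumReady WindowReady) (vNonneg_LQ StCol') (initV_LQ_stColP le_rfl) h
      (landLeSig_cumReady StCol'))


end RhIdea6.G20.W07C12.StColP
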